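import Literature.InformationTheory.QuantumCodes.QuasiAbelianLPDistance
import HarnessLib

/-!
# Quasi-abelian lifted-product codes: the non-degeneracy criterion behind the distance UPPER bounds
# (Kovalev–Pryadko 2013 Thm 6 / Lin–Pryadko 2024 Statement 13) — proof of the mechanism

Topic `InformationTheory/QuantumCodes`; namespace `Literature.InformationTheory.QuantumCodes.LiftedProduct`.
LADDER-QEC (cell `qec`), LIT-3 constructions; companion of `QuasiAbelianLPDistance.lean` (the LOWER bound,
Lin–Pryadko Statement 12 = Kovalev–Pryadko Thm 5).

Sources. The upper bounds of A. A. Kovalev, L. P. Pryadko, PRA **88** (2013) 012311 = arXiv:1212.6703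
[KovalevPryadko2013Hyperbicycle], **Theorem 6** (chunk p0012 L5–13: «consider vector `u ≡ (e ⊗ c, 0)`, where
`c ∈ 𝒞_{ℋ₁}^{(p)}` and `wgt(e) = 1`. As long as `k̃₂^{(p)} > 0`, we can always select such `e` that `u` is not a linear
combination of rows of `G_Z`, which would indicate that `D ≤ wgt(c)`»), and of H.-K. Lin, L. P. Pryadko, PRA **109**
(2024) 022407 = arXiv:2306.16400 [LinPryadko2024], **Statement 13** (chunk p0012 L1–10), whose proof (§VIII.F, chunk
p0020 L58–84) ends: «take any non-zero vector `u ∈ C_A^⊥ ∩ C_J`; the corresponding pair `(u, 0)` is clearly a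
`Z`-codeword in the 2BGA code, and we just need to verify that it is not degenerate … `B^T z = 0` … reads … `by = 0`
… which ensures that `uy ≠ 0`, and thus for any `w ∈ F[G]`, `(u − wb)y = uy ≠ 0`, which guarantees that the pair
`(u, 0)` be a non-degenerate `Z`-codeword in `LP[a,b]`», rest on one mechanism: **a `Z`-cycle supported on the
left block, `(M, 0)` with `A M = 0`, is NOT a stabilizer as soon as `M y ≠ 0` for some `y` with `Bᵗ y = 0`** (because
stabilizers have left block `W Bᵗ`). This file proves the mechanism for the quasi-abelian lifted product `LP(A,B)`
over `F[N]` in the flat, `N`-equivariant coordinates of `QuasiAbelianLPDistance.lean`, and the resulting upper bound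
`d ≤ wt(M, 0)`.

What is NOT typed: Lin–Pryadko's ideal-theoretic SUFFICIENT CONDITION for `uy ≠ 0` («`J` a maximal ideal … the
product of any two non-zero elements in a maximum ideal is non-zero», chunk p0011 L124–125) — it is false as printed
(qec FINDINGS E-8: in `𝔽₂[ℤ₇]`, `J = (1+x)`, `u = (1+x)(1+x+x³)`, `y = (1+x)(1+x²+x³)`, `uy = 0`; the intended reading
is presumably a minimal ideal of a semisimple `F[N]`, as for the irreducible factor `p(x)` of [KovalevPryadko2013Hyperbicycle]);
the theorems below take the condition `M y ≠ 0` itself as the hypothesis, which is what the printed proofs use.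

## What is proved (0 named facts)

* `mem_rowSpace_zMatrix_iff` — `e ∈ rowsp 𝔅(H_Z) ⟺ 𝐌_e = G 𝔅(Bᵗ) ∧ 𝐍_e = 𝔅(A) G` for some `N`-equivariant `G`
  (both directions; the «if» half is `mem_rowSpace_zMatrix_of_chamber` of the companion file);
* `not_mem_rowSpace_zMatrix_of_left_witness` / `_of_right_witness` — the mechanism: `𝐌_e Y ≠ 0` with `𝔅(Bᵗ) Y = 0`
  (resp. `Y 𝐍_e ≠ 0` with `Y 𝔅(A) = 0`) ⟹ `e` is not a `Z`-stabilizer;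
* `cssMinDist_le_hammingNorm_of_left_witness` — hence `d ≤ wt(e)` for such a `Z`-cycle `e`;
* `padLeft μ`, `leftMat_padLeft`, `rightMat_padLeft`, `padLeft_mem_pcCode_xMatrix_iff` — the left-block vectors
  `(M, 0)`: `(M, 0) ∈ ker 𝔅(H_X) ⟺ 𝔅(A) 𝔅(M) = 0`;
* `cssMinDist_le_hammingNorm_padLeft` — **`d(LP(A,B)) ≤ wt(M)` whenever `A M = 0`, `Bᵗ y = 0` and `M y ≠ 0`**
  (Kovalev–Pryadko Thm 6 / Lin–Pryadko Statement 13, mechanism form).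
-/

namespace Literature.InformationTheory.QuantumCodes

open Matrix

namespace LiftedProduct

section Upper

variable {F : Type*} [Field F] [DecidableEq F] {N : Type*} [AddCommGroup N] [Fintype N] [DecidableEq N]
variable {mA nA mB nB : Type*} [Fintype mA] [Fintype nA] [Fintype mB] [Fintype nB]
  [DecidableEq mA] [DecidableEq nA] [DecidableEq mB] [DecidableEq nB]

omit [DecidableEq F] [Fintype mA] [Fintype mB] [DecidableEq mA] [DecidableEq mB] in
/-- **`Z`-stabilizers of `LP(A,B)` in `R`-matrix form (both directions):** `e = H_Zᵀ w` iff
`𝐌_e = G 𝔅(Bᵗ)` and `𝐍_e = 𝔅(A) G` for an `N`-equivariant `G` (namely `G (j,a) (u,h) = w ((j,u), a − h)`).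
[cite: LinPryadko2024, §VIII.F proof of Statement 13 (arXiv:2306.16400 chunk p0020 L80–84: a degenerate `(u,0)` has `u = wb`)]
[cite: KovalevPryadko2013Hyperbicycle, proof of Thm 6 (arXiv:1212.6703 chunk p0012 L7–9: «not a linear combination of rows of G_Z»)] -/
theorem mem_rowSpace_zMatrix_iff (α : mA → nA → N → F) (β : mB → nB → N → F)
    (e : (((nA × mB) ⊕ (mA × nB)) × N) → F) :
    e ∈ rowSpace (zMatrix (fun i j => circulant (α i j)) (fun s u => circulant (β s u))) ↔
      ∃ G : Matrix (nA × N) (nB × N) F, IsEquivariant G ∧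
        leftMat e = G * flat (fun u s => β s u) ∧ rightMat e = flat α * G := by
  constructor
  · intro he
    obtain ⟨w, hw⟩ := (mem_rowSpace_iff _ e).1 he
    refine ⟨Matrix.of fun x y => w ((x.1, y.1), x.2 - y.2), fun _ _ _ _ _ => by simp [add_sub_add_right_eq_sub],
      ?_, ?_⟩
    · ext ⟨j, g⟩ ⟨s, h⟩
      rw [leftMat_apply, ← hw, vecMul_zMatrix_inl, mul_apply, Fintype.sum_prod_type]
      refine Finset.sum_congr rfl fun u _ => ?_
      simp only [of_apply, flat_apply]
      refine Fintype.sum_equiv (Equiv.subLeft g) _ _ fun a => ?_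
      simp only [Equiv.subLeft_apply, sub_sub_cancel]
      congr 1
      abel_nf
    · ext ⟨i, g⟩ ⟨u, h⟩
      rw [rightMat_apply, ← hw, vecMul_zMatrix_inr, mul_apply, Fintype.sum_prod_type]
      refine Finset.sum_congr rfl fun j _ => ?_
      simp only [of_apply, flat_apply]
      refine Fintype.sum_equiv (Equiv.addRight h) _ _ fun a => ?_
      simp only [Equiv.coe_addRight, add_sub_cancel_right]
      rw [mul_comm, sub_sub]
      congr 2
      rw [add_comm]
  · rintro ⟨G, hG, hM, hN⟩
    exact mem_rowSpace_zMatrix_of_chamber α β hG hM hN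

omit [DecidableEq F] [Fintype mA] [DecidableEq mA] [DecidableEq mB] in
/-- **The non-degeneracy mechanism (left block):** if `𝐌_e Y ≠ 0` for some `Y` with `𝔅(Bᵗ) Y = 0`, then `e` is not a
`Z`-stabilizer of `LP(A,B)` (a stabilizer has `𝐌_e = G 𝔅(Bᵗ)`, so `𝐌_e Y = G 𝔅(Bᵗ) Y = 0`).
[cite: LinPryadko2024, §VIII.F proof of Statement 13 (arXiv:2306.16400 chunk p0020 L76–84: «by = 0 … uy ≠ 0, and thus for any w ∈ F[G], (u − wb)y = uy ≠ 0, which guarantees that the pair (u,0) be a non-degenerate Z-codeword»)]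
[cite: KovalevPryadko2013Hyperbicycle, proof of Thm 6 (arXiv:1212.6703 chunk p0012 L5–13)] -/
theorem not_mem_rowSpace_zMatrix_of_left_witness (α : mA → nA → N → F) (β : mB → nB → N → F)
    {e : (((nA × mB) ⊕ (mA × nB)) × N) → F} {T : Type*} (Y : Matrix (mB × N) T F)
    (hY : flat (fun u s => β s u) * Y = 0) (hMY : leftMat e * Y ≠ 0) :
    e ∉ rowSpace (zMatrix (fun i j => circulant (α i j)) (fun s u => circulant (β s u))) := by
  intro he
  obtain ⟨G, -, hM, -⟩ := (mem_rowSpace_zMatrix_iff α β e).1 he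
  exact hMY (by rw [hM, Matrix.mul_assoc, hY, Matrix.mul_zero])

omit [DecidableEq F] [Fintype mB] [DecidableEq mA] [DecidableEq mB] in
/-- **The non-degeneracy mechanism (right block):** if `Y 𝐍_e ≠ 0` for some `Y` with `Y 𝔅(A) = 0`, then `e` is not a
`Z`-stabilizer (a stabilizer has `𝐍_e = 𝔅(A) G`). [cite: LinPryadko2024, after Statement 13 (arXiv:2306.16400 chunk p0012 L11–12: «there is also an upper bound in terms of the distance of the subcode C_B^⊥ ∩ C_J»)] -/
theorem not_mem_rowSpace_zMatrix_of_right_witness (α : mA → nA → N → F) (β : mB → nB → N → F)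
    {e : (((nA × mB) ⊕ (mA × nB)) × N) → F} {T : Type*} (Y : Matrix T (mA × N) F)
    (hY : Y * flat α = 0) (hYN : Y * rightMat e ≠ 0) :
    e ∉ rowSpace (zMatrix (fun i j => circulant (α i j)) (fun s u => circulant (β s u))) := by
  intro he
  obtain ⟨G, -, -, hN⟩ := (mem_rowSpace_zMatrix_iff α β e).1 he
  exact hYN (by rw [hN, ← Matrix.mul_assoc, hY, Matrix.zero_mul])

/-- **Upper bound from a witnessed `Z`-cycle:** a `Z`-cycle `e` (`𝔅(H_X) e = 0`) with a left witness `Y`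
(`𝔅(Bᵗ) Y = 0`, `𝐌_e Y ≠ 0`) bounds the minimum distance of `LP(A,B)`: `d ≤ wt(e)`.
[cite: KovalevPryadko2013Hyperbicycle, Thm 6 and proof (arXiv:1212.6703 chunk p0012 L5–13: «which would indicate that D ≤ wgt(c)»)]
[cite: LinPryadko2024, Statement 13 and proof (arXiv:2306.16400 chunk p0012 L1–10, p0020 L58–84)] -/
theorem cssMinDist_le_hammingNorm_of_left_witness (α : mA → nA → N → F) (β : mB → nB → N → F)
    {e : (((nA × mB) ⊕ (mA × nB)) × N) → F}
    (he : e ∈ pcCode (xMatrix (fun i j => circulant (α i j)) (fun s u => circulant (β s u))))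
    {T : Type*} (Y : Matrix (mB × N) T F) (hY : flat (fun u s => β s u) * Y = 0) (hMY : leftMat e * Y ≠ 0) :
    cssMinDist (xMatrix (fun i j => circulant (α i j)) (fun s u => circulant (β s u)))
        (zMatrix (fun i j => circulant (α i j)) (fun s u => circulant (β s u))) ≤ (hammingNorm e : ℕ∞) :=
  cssMinDist_le_hammingNorm (Or.inl ⟨he, not_mem_rowSpace_zMatrix_of_left_witness α β Y hY hMY⟩)

/-! ### Left-block cycles `(M, 0)` -/

/-- The qubit vector `(M, 0)` supported on the left block, `M = (circulant (μ j s))`: `(inl (j,s), g) ↦ μ j s g`,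
`(inr _, _) ↦ 0`. (definition, auxiliary) [cite: LinPryadko2024, §VIII.F (arXiv:2306.16400 chunk p0020 L61–63: «the corresponding pair (u, 0) is clearly a Z-codeword»)]
[cite: KovalevPryadko2013Hyperbicycle, proof of Thm 6 (arXiv:1212.6703 chunk p0012 L5–6: «u ≡ (e ⊗ c, 0)»)] -/
def padLeft (μ : nA → mB → N → F) : (((nA × mB) ⊕ (mA × nB)) × N) → F
  | (Sum.inl (j, s), g) => μ j s g
  | (Sum.inr _, _) => 0

omit [DecidableEq F] [Fintype N] [DecidableEq N] [Fintype mA] [Fintype nA] [Fintype mB] [Fintype nB] [DecidableEq mA]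
  [DecidableEq nA] [DecidableEq mB] [DecidableEq nB] in
/-- `𝐌_{(M,0)} = 𝔅(M)`. [cite: LinPryadko2024, §VIII.F (arXiv:2306.16400 chunk p0020 L61–63)] -/
theorem leftMat_padLeft (μ : nA → mB → N → F) : leftMat (padLeft (mA := mA) (nB := nB) μ) = flat μ := by
  ext ⟨j, g⟩ ⟨s, h⟩
  rfl

omit [DecidableEq F] [Fintype N] [DecidableEq N] [Fintype mA] [Fintype nA] [Fintype mB] [Fintype nB] [DecidableEq mA]
  [DecidableEq nA] [DecidableEq mB] [DecidableEq nB] in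
/-- `𝐍_{(M,0)} = 0`. [cite: LinPryadko2024, §VIII.F (arXiv:2306.16400 chunk p0020 L61–63)] -/
theorem rightMat_padLeft (μ : nA → mB → N → F) : rightMat (padLeft (mA := mA) (nB := nB) μ) = 0 := by
  ext ⟨i, g⟩ ⟨u, h⟩
  rfl

omit [DecidableEq F] [DecidableEq nA] [DecidableEq nB] in
/-- **`(M, 0)` is a `Z`-cycle iff `A M = 0`** (`𝔅(A) 𝔅(M) = 0`).
[cite: LinPryadko2024, §VIII.F (arXiv:2306.16400 chunk p0020 L61–63: «u ∈ C_A^⊥ … the corresponding pair (u,0) is clearly a Z-codeword»)] -/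
theorem padLeft_mem_pcCode_xMatrix_iff (α : mA → nA → N → F) (β : mB → nB → N → F) (μ : nA → mB → N → F) :
    padLeft μ ∈ pcCode (xMatrix (fun i j => circulant (α i j)) (fun s u => circulant (β s u))) ↔
      flat α * flat μ = 0 := by
  rw [mem_pcCode_xMatrix_iff, leftMat_padLeft, rightMat_padLeft, Matrix.zero_mul]

/-- **Kovalev–Pryadko Theorem 6 / Lin–Pryadko Statement 13, mechanism form: `d(LP(A,B)) ≤ wt(M)`** for every
`R`-matrix `M` (coefficients `μ`) with `A M = 0` that admits a witness `Y` with `Bᵗ Y = 0` and `M Y ≠ 0` (flat: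
`𝔅(A)𝔅(M) = 0`, `𝔅(Bᵗ) Y = 0`, `𝔅(M) Y ≠ 0`). The printed statements supply `M Y ≠ 0` from structure (an irreducible
factor `p(x)` of `x^c − 1`, resp. — misprinted, see the module docstring — a «maximal» ideal `J` of `F[N]`); here the
condition itself is the hypothesis. [cite: KovalevPryadko2013Hyperbicycle, Thm 6 (arXiv:1212.6703 chunk p0012 L5–13)]
[cite: LinPryadko2024, Statement 13 (arXiv:2306.16400 chunk p0012 L1–10) and its proof §VIII.F (chunk p0020 L58–84)] -/
theorem cssMinDist_le_hammingNorm_padLeft (α : mA → nA → N → F) (β : mB → nB → N → F) (μ : nA → mB → N → F)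
    (hAM : flat α * flat μ = 0) {T : Type*} (Y : Matrix (mB × N) T F) (hY : flat (fun u s => β s u) * Y = 0)
    (hMY : flat μ * Y ≠ 0) :
    cssMinDist (xMatrix (fun i j => circulant (α i j)) (fun s u => circulant (β s u)))
        (zMatrix (fun i j => circulant (α i j)) (fun s u => circulant (β s u))) ≤
      (hammingNorm (padLeft (mA := mA) (nB := nB) μ) : ℕ∞) :=
  cssMinDist_le_hammingNorm_of_left_witness α β ((padLeft_mem_pcCode_xMatrix_iff α β μ).2 hAM) Y hY
    (by rwa [leftMat_padLeft])

end Upper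

end LiftedProduct

end Literature.InformationTheory.QuantumCodes
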